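import Summits.BirchSwinnertonDyer.Rank1Residual.X2.RouteGSplitDisplay294576df1
import Summits.BirchSwinnertonDyer.Rank1Residual.X2.TwistParityStabilityEvenTwist
import HarnessLib

/-!
# Route G at a SPLIT multiplicative Eisenstein `3` — the pair `294576df1 @ 3 ← 490960cm1 @ 3`: the GALOIS-SIDE
# cell datum `¬ GVPar W 3` DISCHARGED IN THE KERNEL by a rational `3`-torsion point on the EVEN twist `E^{(19)}`
# (cell `bsd-eis`, seat `bsd-eis-k5-c3` g2; THEOREMS ONLY; answers planner Q-g15-1 for the one xone target
# without rational `3`-torsion)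

HONEST FRAMING (FULL-BSD rank-≤1 programme D-0033, cell `bsd-eis`, home `run/shared/lean/pub/bsd-eis/`; row
A10-split: 83 cells `(E₀, 3)`, `r = 0`, split multiplicative Eisenstein `3`, `¬GVPar`). Nothing booked, no label
moves. The X1-relative ("xone") display `X2/RouteGSplitDisplay294576df1.lean` carries the Galois-side HYPOTHESIS
`hngv : ¬ GVPar W 3`. `W = 294576df1 = [0, 1, 0, 3851, -441757]` (`N = 294576 = 2⁴·3·17·19²`, `#E(ℚ)_tors = 1` on both members of
the class) has NO rational `3`-torsion: its rational line is `{O, ±P}` with `P = (101, 228√19)`, character the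
even real quadratic `χ` of `ℚ(√19)`, unramified at `3`. Kernel certificate: the EVEN quadratic twist
`W^{(19)} = W.quadraticTwist 19 = [0, 19, 0, 1390211, -3030011263]` (literally, change of variables `1`) carries the rational point
`(1919, 82308)` of order `3` (`Ψ₃(1919) = 0`, `Ψ₂Sq(1919) = 27098427456 ≠ 0`), and `19 > 0`, `3 ∤ 19`, so
`X2.not_gvPar_of_twist_pos_of_nsmul_eq_zero_of_mult` (`X2/TwistParityStabilityEvenTwist.lean`, this seat; the
multiplicative twin of x1a's `not_gvPar_of_twist_pos_of_nsmul_eq_zero`) gives `¬ GVPar W 3`, granted the two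
Tate-uniformisation facts `hT`, `hT'` the display already binds. The two heads below are the display's heads with
`hngv` REMOVED; every other binder is verbatim. PER-PAIR CERTIFICATE HYPOTHESES LEFT [instrument]: `hr'`, `hunit'`,
`hμ0`, `hlam`, `hμ0'`, `hlam'`, `hk`, `hn`.
Refs: [GreenbergVatsal2000] Thm (1.3) + remark, §2 p. 28; [SilvermanAEC2009] III Ex. 3.7, X.5 Cor. 5.4; [SilvermanATAEC1994] V.5.3.
-/

set_option autoImplicit false

noncomputable section

open scoped Classical

open WeierstrassCurve NumberField IsDedekindDomain
  Literature.NumberTheory.EllipticCurves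
  Literature.NumberTheory.EllipticCurves.ModularForms
  Literature.NumberTheory.EllipticCurves.Rank1Residual
  Literature.NumberTheory.EllipticCurves.Rank1Residual.Typed
  Literature.NumberTheory.EllipticCurves.Rank1Residual.X11RankOneCertificates
  Literature.NumberTheory.EllipticCurves.Wuthrich2014
  Literature.NumberTheory.EllipticCurves.SteinWuthrich2013
  Literature.NumberTheory.EllipticCurves.Greenberg1999
  Literature.NumberTheory.EllipticCurves.GreenbergVatsal2000
  Summit.BirchSwinnertonDyer.BirchSwinnertonDyer.Rank1Residual.IntModel
  Summit.BirchSwinnertonDyer.BirchSwinnertonDyer.Rank1Residual.X11RankOne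
  Summit.BirchSwinnertonDyer.Rank1Residual.X11b
  Summit.BirchSwinnertonDyer.Rank1Residual.X1.CongruenceTransfer
  Summit.BirchSwinnertonDyer.Rank1Residual.X2.LocalDeltaCalculus
  Summit.BirchSwinnertonDyer.Rank1Residual
  Summit.BirchSwinnertonDyer.Rank1Residual.X2.RouteGSplitDisplay294576df1Local
  Summit.BirchSwinnertonDyer.BirchSwinnertonDyer.Theorems.Rank1ResidualX1Defs
  Summit.BirchSwinnertonDyer.BirchSwinnertonDyer.Theorems

namespace Summit.BirchSwinnertonDyer.Rank1Residual.X2.RouteGSplitDisplay294576df1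

/-! ## §1 The even twist, its rational `3`-torsion point, and `¬ GVPar` in the kernel -/

/-- The twist model `[0, 19, 0, 1390211, -3030011263]` is elliptic (`Δ ≠ 0`). [folklore] -/
theorem isElliptic_twist19_294576df1 : (⟨0, 19, 0, 1390211, -3030011263⟩ : WeierstrassCurve ℚ).IsElliptic :=
  isElliptic_of_discOf_ne_zero 0 19 0 1390211 (-3030011263) (by decide +kernel)

/-- **`[0, 19, 0, 1390211, -3030011263]` IS the quadratic twist of `294576df1` by `19`** (the tree's `quadraticTwist d = ⟨0, d·b₂/4, 0, d²·b₄/2,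
d³·b₆/4⟩`, here with integral entries; change of variables `1`). [cite: SilvermanAEC2009, X.2 Prop. 2.4] -/
theorem twist19_294576df1 :
    (1 : VariableChange ℚ) • (⟨0, 19, 0, 1390211, -3030011263⟩ : WeierstrassCurve ℚ) =
      (⟨0, 1, 0, 3851, -441757⟩ : WeierstrassCurve ℚ).quadraticTwist (((19 : ℤ)) : ℚ) := by
  rw [one_smul]
  ext <;> norm_num [quadraticTwist, WeierstrassCurve.b₂, WeierstrassCurve.b₄, WeierstrassCurve.b₆]

/-- **`P = (1919, 82308)` is a rational point of order `3` on the twist `[0, 19, 0, 1390211, -3030011263]`** (`Ψ₃(1919) = 0`,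
`Ψ₂Sq(1919) = 27098427456 ≠ 0`). [cite: SilvermanAEC2009, III Ex. 3.7] -/
theorem addOrderOf_torsionPoint_twist19_294576df1
    (hP : (⟨0, 19, 0, 1390211, -3030011263⟩ : WeierstrassCurve ℚ).toAffine.Nonsingular (1919 : ℚ) (82308 : ℚ)) :
    addOrderOf (Affine.Point.some (1919 : ℚ) (82308 : ℚ) hP) = 3 := by
  haveI := isElliptic_twist19_294576df1
  exact RouteGThreeTorsion.addOrderOf_eq_three_of_eval_Ψ₃ _ hP
    (by norm_num [WeierstrassCurve.Ψ₃, WeierstrassCurve.b₂, WeierstrassCurve.b₄, WeierstrassCurve.b₆,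
          WeierstrassCurve.b₈])
    (by rw [KernelDisc.eval_Ψ₂Sq]; norm_num [WeierstrassCurve.b₂, WeierstrassCurve.b₄, WeierstrassCurve.b₆])

/-- **`¬ GVPar (294576df1) 3` — the cell datum of row A10 IN THE KERNEL** for a target without rational `3`-torsion: the
rational `3`-torsion point `(1919, 82308)` of the EVEN twist `E^{(19)}` (`19 > 0`, `3 ∤ 19`) transports to a rational
line of `E[3]` unramified at `3` and even (co-type), which at the odd SPLIT multiplicative prime `3` forces type A
(`X2.not_gvPar_of_twist_pos_of_nsmul_eq_zero_of_mult`; Tate uniformisation `hT`, `hT'` as in the display).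
[cite: GreenbergVatsal2000, Thm. (1.3) and the remark after it, §2 p. 28] [cite: SilvermanAEC2009, X.5 Cor. 5.4] -/
theorem not_gvPar_294576df1
    (hT : Silverman1994_thmV53_corV54_tateUniformisation.{0})
    (hT' : Silverman1994_thmV53_tateUniformisation.{0}) :
    ¬ GVPar (⟨0, 1, 0, 3851, -441757⟩ : WeierstrassCurve ℚ) 3 := by
  haveI := isElliptic_294576df1
  haveI := isGloballyMinimal_294576df1
  haveI := isElliptic_twist19_294576df1
  have hP : (⟨0, 19, 0, 1390211, -3030011263⟩ : WeierstrassCurve ℚ).toAffine.Nonsingular (1919 : ℚ) (82308 : ℚ) :=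
    WeierstrassCurve.Affine.equation_iff_nonsingular.mp
      ((WeierstrassCurve.Affine.equation_iff _ _).mpr (by norm_num))
  have h3 : (3 : ℕ) • (Affine.Point.some (1919 : ℚ) (82308 : ℚ) hP) = 0 :=
    addOrderOf_torsionPoint_twist19_294576df1 hP ▸ addOrderOf_nsmul_eq_zero _
  exact not_gvPar_of_twist_pos_of_nsmul_eq_zero_of_mult _ hT' hT (by decide)
    split_294576df1.hasMultiplicativeReductionAtPrime (d := 19) (by norm_num) (by decide) 1 twist19_294576df1
    _ (Affine.Point.some_ne_zero hP) h3

/-! ## §2 The display heads without the Galois-side binder `hngv` -/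

/-- **ROUTE G DISPLAY `X2.MazurMainConjectureAt 294576df1 3`, Galois side ENTIRELY in the kernel** — the head
`mazurMainConjectureAt_294576df1_at_three` of part 2 with its binder `hngv : ¬ GVPar W 3` discharged by
`not_gvPar_294576df1`; all other binders verbatim (REGISTERED [PUB] facts + the per-pair INSTRUMENT certificates
`hr'`, `hunit'`, `hμ0`, `hlam`, `hμ0'`, `hlam'`, `hk`, `hn`). Nothing booked.
[cite: GreenbergVatsal2000, Thm. (1.4), §1 (5)–(7), §2 Prop. (2.4) pp. 20–27] [cite: Wuthrich2014, Thm. 16 (p. 397)]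
[cite: SteinWuthrich2013, Thm. 6.1 (p. 20), clause (1)] [cite: Fisher2012Hessian, §13] -/
theorem mazurMainConjectureAt_294576df1_at_three'
    (hWu : thm16_charIdeal_dvd_multiplicative_of_reducible)
    (hW16 : Wuthrich2014.charIdeal_dvd_padicLFunction) (hW21 : sha_dvd_analyticSha)
    (hGr : greenberg_charValue_rankZero)
    (hGZK : rank_eq_analyticRank_of_analyticRank_le_one) (hmod : hasEntireLFunction_rat)
    (hpar : nonempty_modularParametrizationData)
    (hT : Silverman1994_thmV53_corV54_tateUniformisation.{0})
    (hT' : Silverman1994_thmV53_tateUniformisation.{0})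
    (hAm : lambda_nonPrimitive_eq_add_sum_delta_multiplicative)
    (hBm : datumSelmer_divisible_of_finite_torsionBy) (hF : datumStrictSelmer_lt_datumSelmer_of_split)
    (hGV : imKummer_ge_greenbergCondition_at_p) (hA7 : lambda_nonPrimitive_eq_add_sum_delta)
    (hB : divisible_nonPrimitiveSelmerInfty_of_mu_eq_zero)
    (W W' : WeierstrassCurve ℚ) [W.IsElliptic] [W.IsGloballyMinimal] [W'.IsElliptic]
    [W'.IsGloballyMinimal] (hW : W = ⟨0, 1, 0, 3851, -441757⟩)
    (hW' : W' = ⟨0, 1, 0, -14560, 2830708⟩)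
    (n n' k : ℕ) (hr' : W'.analyticRank = 0) (hunit' : ∃ q : ℚ, shaAn W' = (q : ℂ) ∧ padicValRat 3 q = 0)
    (hμ0 : AnalyticMuLE W 3 0) (hlam : AnalyticLambdaEq W 3 n)
    (hμ0' : X1.MuPart.AnalyticMuLE W' 3 0) (hlam' : X1.ParitySqueeze.AnalyticLambdaEq W' 3 n')
    (hk : (k : ℤ) = n' + (-1) - 1) (hn : n ≤ k + 1) :
    X2.MazurMainConjectureAt W 3 := by
  have hngv : ¬ GVPar W 3 := by subst hW; exact not_gvPar_294576df1 hT hT'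
  exact mazurMainConjectureAt_294576df1_at_three hWu hW16 hW21 hGr hGZK hmod hpar hT hT' hAm hBm hF hGV hA7 hB W W'
    hW hW' hngv n n' k hr' hunit' hμ0 hlam hμ0' hlam' hk hn

/-- **`BSD(294576df1, 3)`, Galois side ENTIRELY in the kernel** — the head `bsdp_294576df1_at_three` of part 2 with
`hngv` discharged by `not_gvPar_294576df1`; all other binders verbatim. Nothing booked.
[cite: GreenbergVatsal2000, Thm. (1.4), §2 Prop. (2.4)] [cite: Wuthrich2014, Thm. 16 (p. 397)]
[cite: SteinWuthrich2013, Thm. 6.1 (p. 20)] [cite: MazurTateTeitelbaum1986Invent, Ch. II §10 Conjecture (BSD(p)) (p. 38)]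
[cite: Miller2011LMS, Def. 1.1] -/
theorem bsdp_294576df1_at_three'
    (hWu : thm16_charIdeal_dvd_multiplicative_of_reducible)
    (hW16 : Wuthrich2014.charIdeal_dvd_padicLFunction) (hW21 : sha_dvd_analyticSha)
    (hGr : greenberg_charValue_rankZero)
    (hJs : thm61_splitMultiplicative) (hJn : thm61_nonsplitMultiplicative)
    (hHs : exists_isSplitMultCanonical) (hHn : exists_isMultCanonical)
    (hGZK : rank_eq_analyticRank_of_analyticRank_le_one) (hmod : hasEntireLFunction_rat)
    (hpar : nonempty_modularParametrizationData)
    (hT : Silverman1994_thmV53_corV54_tateUniformisation.{0})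
    (hT' : Silverman1994_thmV53_tateUniformisation.{0})
    (hAm : lambda_nonPrimitive_eq_add_sum_delta_multiplicative)
    (hBm : datumSelmer_divisible_of_finite_torsionBy) (hF : datumStrictSelmer_lt_datumSelmer_of_split)
    (hGV : imKummer_ge_greenbergCondition_at_p) (hA7 : lambda_nonPrimitive_eq_add_sum_delta)
    (hB : divisible_nonPrimitiveSelmerInfty_of_mu_eq_zero)
    (W W' : WeierstrassCurve ℚ) [W.IsElliptic] [W.IsGloballyMinimal] [W'.IsElliptic]
    [W'.IsGloballyMinimal] (hW : W = ⟨0, 1, 0, 3851, -441757⟩)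
    (hW' : W' = ⟨0, 1, 0, -14560, 2830708⟩)
    (hGS : greenberg_stevens (W := W) (p := 3))
    (hr : W.analyticRank = 0)
    (n n' k : ℕ) (hr' : W'.analyticRank = 0) (hunit' : ∃ q : ℚ, shaAn W' = (q : ℂ) ∧ padicValRat 3 q = 0)
    (hμ0 : AnalyticMuLE W 3 0) (hlam : AnalyticLambdaEq W 3 n)
    (hμ0' : X1.MuPart.AnalyticMuLE W' 3 0) (hlam' : X1.ParitySqueeze.AnalyticLambdaEq W' 3 n')
    (hk : (k : ℤ) = n' + (-1) - 1) (hn : n ≤ k + 1) :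
    BSDp W 3 := by
  have hngv : ¬ GVPar W 3 := by subst hW; exact not_gvPar_294576df1 hT hT'
  exact bsdp_294576df1_at_three hWu hW16 hW21 hGr hJs hJn hHs hHn hGZK hmod hpar hT hT' hAm hBm hF hGV hA7 hB W W'
    hW hW' hGS hr hngv n n' k hr' hunit' hμ0 hlam hμ0' hlam' hk hn

end Summit.BirchSwinnertonDyer.Rank1Residual.X2.RouteGSplitDisplay294576df1

end
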